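/-
Origin: expansion seat `planner-pub-hodgecm-pv14-0`, handover v2 2026-08-18T04:04:26Z (`HOME/pub-hodgecm-pv14/lean/Pv14/PerL34/P43Frame.lean`, md5 d8b1dbf3, 193 lines);
landed by the gen-5 packager in gate run 21 as `HodgeCM/PerL34/P43_frame.lean` (verbatim).
-/
/-
Origin: HOME/pub-hodgecm-pv14/lean/Pv14/PerL34/P43Frame.lean — session planner-pub-hodgecm-pv14-0 (unit pub-hodgecm-pv14,
DAG-NODE PROVER #14, node N33b holder).  Intended final place: `HodgeCM/PerL34/P43_frame.lean` (imports the landed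
`HodgeCM.PerL34.WedgeNonvanishing` (pv03) and `HodgeCM.PerL34.P43_lineSpan` (pv02)).
LEMMAS.md v3 §8 FRONTIER item (iv) — "N33b's Hecke-translate equivariance of theta one-forms under G_U(L₀)" at the
BALL level (pv03's `WedgeNonvanishing.StableUnder Δ A 𝒰ᵢ`, prl1's `BallFacts.transl`) versus the GROUP level where
it is kernel-proved (pv14 `P43Forms.thetaP_equivariance` C3, pv02 `LineSpanData.N33c_of`: `γ^* 𝒰_i = 𝒰_i`).
This file is the D2/D6 FRAME DICTIONARY between the two, KERNEL: nothing cited, nothing asserted.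
-/
import Summits.HodgeConjecture.HodgeCM.PerL34.WedgeNonvanishing
import Summits.HodgeConjecture.HodgeCM.PerL34.P43_lineSpan

set_option autoImplicit false
set_option linter.unusedSectionVars false

/-!
# The frame dictionary: one-forms on `𝔹² = G/K` ↔ functions on `G = U(2,1)`

For a `G`-space `X` with base point `x₀`, a fibre `W` and an automorphy cocycle `A g x : W → W`
(`γ^*`/push-forward acts on `W`-valued forms `u : X → W` by `(γ ⋆ u)(γ • x) = A γ x (u x)`, exactly as in pv01/pv03's
`StableUnder`), the FRAME READING `R u : G → W`, `(R u)(g) := A g⁻¹ (g • x₀) (u (g • x₀))` ("read `u` at `g • x₀` in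
the frame transported back to `x₀`") satisfies, from the COCYCLE IDENTITY `A (g h) x = A g (h • x) ∘ A h x` alone
(chain rule for the canonical automorphy factor — PRINT-elementary / dictionary D6):
* `frameRead_push` : `R (γ ⋆ u) = lTransl γ⁻¹ (R u)` (pv02's `lTransl g φ = φ (g · )`), i.e. push-forward of forms on
  the ball is left translation of functions on the group;
* `stable_comap` : if a space `𝒱` of functions on `G` is stable under `lTransl γ`, `γ ∈ Δ` (a subgroup), then the
  space of forms `R⁻¹ 𝒱` is `Δ`-stable in the sense of `StableUnder` — and conversely `map_stable_of_stableUnder`;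
* `frameRead_injective` : `R` is injective when the cocycle is fibrewise injective and `G` is transitive on `X`
  (pv03's `Print_cocycle.1`, `Print_transitive`), so the dictionary is faithful;
* `stable_iSup` / `stableUnder_iSup` : stability passes to suprema `⨆ d, gen d` (the shape of pv03's `𝒰ᵢ`);
* `stableUnder_comap` : the same for pv03's literal `WedgeNonvanishing.StableUnder Δ A` (`A` continuous linear);
* `stable_comap_U` : applied to pv02's `LineSpanData` — from pv02's KERNEL `N33c_statement` (`γ^* 𝒰_i = 𝒰_i` on
  `G_U`), the ball-level spaces `R⁻¹ 𝒰_i` are stable under the image of `G_U(L₀)`: the ball-level Hecke-translate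
  equivariance of theta one-forms is KERNEL modulo (a) the cocycle identity and (b) the DEFINITIONAL identification
  "one-forms of type `𝒰_i` on `𝔹²`" = `R⁻¹ 𝒰_i` (D2/D6).
-/

namespace HodgeCM
namespace PerL34
namespace P43Frame

section Generic

variable {G X W : Type*} [Group G] [MulAction G X] [AddCommGroup W] [Module ℂ W]
variable (A : G → X → (W →ₗ[ℂ] W)) (x₀ : X)

/-- The cocycle identity of an automorphy factor (chain rule): `A (g h) x = A g (h • x) ∘ A h x`. -/
def Cocycle : Prop := ∀ (g h : G) (x : X) (w : W), A (g * h) x w = A g (h • x) (A h x w)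

/-- The frame reading `R u (g) = A g⁻¹ (g • x₀) (u (g • x₀))` of a `W`-valued form `u` on `X`. -/
def frameRead : (X → W) →ₗ[ℂ] (G → W) where
  toFun u g := A g⁻¹ (g • x₀) (u (g • x₀))
  map_add' u v := by ext g; simp
  map_smul' c u := by ext g; simp

/-- Push-forward of forms through the cocycle: `(γ ⋆ u)(y) = A γ (γ⁻¹ • y) (u (γ⁻¹ • y))`. -/
def push (γ : G) : (X → W) →ₗ[ℂ] (X → W) where
  toFun u y := A γ (γ⁻¹ • y) (u (γ⁻¹ • y))
  map_add' u v := by ext y; simp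
  map_smul' c u := by ext y; simp

/-- (Ported verbatim from the HodgeCMPerL package; no docstring in the source.) -/
theorem frameRead_apply (u : X → W) (g : G) : frameRead A x₀ u g = A g⁻¹ (g • x₀) (u (g • x₀)) := rfl

/-- (Ported verbatim from the HodgeCMPerL package; no docstring in the source.) -/
theorem push_apply (γ : G) (u : X → W) (y : X) : push A γ u y = A γ (γ⁻¹ • y) (u (γ⁻¹ • y)) := rfl

/-- `(γ ⋆ u)(γ • x) = A γ x (u x)` — the defining relation in `StableUnder`. -/
theorem push_apply_smul (γ : G) (u : X → W) (x : X) : push A γ u (γ • x) = A γ x (u x) := by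
  rw [push_apply, inv_smul_smul]

/-- A form `u'` satisfying the `StableUnder` relation for `(γ, u)` IS the push-forward. -/
theorem eq_push_of_rel (γ : G) (u u' : X → W) (h : ∀ x, u' (γ • x) = A γ x (u x)) : u' = push A γ u := by
  ext y
  rw [push_apply, ← h, smul_inv_smul]

/-- **Push-forward on the ball = left translation on the group**: `R (γ ⋆ u) = lTransl γ⁻¹ (R u)`. -/
theorem frameRead_push (hA : Cocycle A) (γ : G) (u : X → W) :
    frameRead A x₀ (push A γ u) = P43.lTransl γ⁻¹ (frameRead A x₀ u) := by
  ext g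
  show A g⁻¹ (g • x₀) (A γ (γ⁻¹ • g • x₀) (u (γ⁻¹ • g • x₀))) =
    A (γ⁻¹ * g)⁻¹ ((γ⁻¹ * g) • x₀) (u ((γ⁻¹ * g) • x₀))
  rw [mul_inv_rev, inv_inv, mul_smul, hA, smul_inv_smul]

/-- **Group-level stability ⇒ ball-level stability.** If `𝒱 ≤ (G → W)` is stable under `lTransl γ`, `γ ∈ Δ`,
then `R⁻¹ 𝒱` is `Δ`-stable for push-forward (the relation of `StableUnder`). -/
theorem stable_comap (hA : Cocycle A) (Δ : Subgroup G) (𝒱 : Submodule ℂ (G → W))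
    (h𝒱 : ∀ γ ∈ Δ, ∀ φ ∈ 𝒱, P43.lTransl γ φ ∈ 𝒱) :
    ∀ γ ∈ Δ, ∀ u ∈ 𝒱.comap (frameRead A x₀), ∃ u' ∈ 𝒱.comap (frameRead A x₀), ∀ x, u' (γ • x) = A γ x (u x) := by
  intro γ hγ u hu
  refine ⟨push A γ u, ?_, fun x => push_apply_smul A γ u x⟩
  rw [Submodule.mem_comap] at hu ⊢
  rw [frameRead_push A x₀ hA]
  exact h𝒱 γ⁻¹ (Δ.inv_mem hγ) _ hu

/-- **Ball-level stability ⇒ group-level stability** (converse direction of the dictionary). -/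
theorem map_stable_of_stableUnder (hA : Cocycle A) (Δ : Subgroup G) (𝒰 : Submodule ℂ (X → W))
    (h𝒰 : ∀ γ ∈ Δ, ∀ u ∈ 𝒰, ∃ u' ∈ 𝒰, ∀ x, u' (γ • x) = A γ x (u x)) :
    ∀ γ ∈ Δ, ∀ φ ∈ 𝒰.map (frameRead A x₀), P43.lTransl γ φ ∈ 𝒰.map (frameRead A x₀) := by
  intro γ hγ φ hφ
  obtain ⟨u, hu, rfl⟩ := Submodule.mem_map.mp hφ
  obtain ⟨u', hu', hrel⟩ := h𝒰 γ⁻¹ (Δ.inv_mem hγ) u hu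
  refine Submodule.mem_map.mpr ⟨u', hu', ?_⟩
  rw [eq_push_of_rel A γ⁻¹ u u' hrel, frameRead_push A x₀ hA, inv_inv]

/-- **The dictionary is faithful**: `R` is injective when the cocycle is fibrewise injective and `G` acts
transitively (pv03's `Print_cocycle.1` and `Print_transitive`). -/
theorem frameRead_injective (hinj : ∀ (g : G) (x : X), Function.Injective (A g x))
    (htr : ∀ x : X, ∃ g : G, g • x₀ = x) : Function.Injective (frameRead A x₀) := by
  intro u v huv
  ext x
  obtain ⟨g, rfl⟩ := htr x
  have := congr_fun huv g
  exact hinj _ _ this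

/-- With a faithful dictionary, `R⁻¹ (R 𝒰) = 𝒰`: ball-level and group-level stability are EQUIVALENT for
`𝒱 = R 𝒰`. -/
theorem comap_map_eq (hinj : ∀ (g : G) (x : X), Function.Injective (A g x))
    (htr : ∀ x : X, ∃ g : G, g • x₀ = x) (𝒰 : Submodule ℂ (X → W)) :
    (𝒰.map (frameRead A x₀)).comap (frameRead A x₀) = 𝒰 :=
  Submodule.comap_map_eq_of_injective (frameRead_injective A x₀ hinj htr) 𝒰

/-- The push-forward relation of `StableUnder` determines `u'`; hence stability passes to SUPREMA of stable
spaces (pv03's `N33c_statement` is stated for `𝒰ᵢ = ⨆ d, genᵢ d`). -/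
theorem push_mem_of_stable (Δ : Subgroup G) (𝒰 : Submodule ℂ (X → W))
    (h𝒰 : ∀ γ ∈ Δ, ∀ u ∈ 𝒰, ∃ u' ∈ 𝒰, ∀ x, u' (γ • x) = A γ x (u x)) {γ : G} (hγ : γ ∈ Δ) {u : X → W}
    (hu : u ∈ 𝒰) : push A γ u ∈ 𝒰 := by
  obtain ⟨u', hu', hrel⟩ := h𝒰 γ hγ u hu
  rwa [← eq_push_of_rel A γ u u' hrel]

/-- (Ported verbatim from the HodgeCMPerL package; no docstring in the source.) -/
theorem stable_iSup {D : Type*} (Δ : Subgroup G) (gen : D → Submodule ℂ (X → W))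
    (h : ∀ d, ∀ γ ∈ Δ, ∀ u ∈ gen d, ∃ u' ∈ gen d, ∀ x, u' (γ • x) = A γ x (u x)) :
    ∀ γ ∈ Δ, ∀ u ∈ ⨆ d, gen d, ∃ u' ∈ ⨆ d, gen d, ∀ x, u' (γ • x) = A γ x (u x) := by
  intro γ hγ u hu
  refine ⟨push A γ u, ?_, fun x => push_apply_smul A γ u x⟩
  induction hu using Submodule.iSup_induction' with
  | mem d u hu => exact Submodule.mem_iSup_of_mem d (push_mem_of_stable A Δ (gen d) (h d) hγ hu)
  | zero => simp
  | add u v _ _ ihu ihv => simpa using Submodule.add_mem _ ihu ihv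

end Generic

section CLM

variable {G X W : Type*} [Group G] [TopologicalSpace X] [MulAction G X] [NormedAddCommGroup W]
  [NormedSpace ℂ W]

/-- **pv03's literal `StableUnder`** for the preimage of a left-translation-stable space of functions on `G`,
continuous-linear cocycle. -/
theorem stableUnder_comap (A : G → X → (W →L[ℂ] W)) (x₀ : X)
    (hA : ∀ (g h : G) (x : X) (w : W), A (g * h) x w = A g (h • x) (A h x w))
    (Δ : Subgroup G) (𝒱 : Submodule ℂ (G → W)) (h𝒱 : ∀ γ ∈ Δ, ∀ φ ∈ 𝒱, P43.lTransl γ φ ∈ 𝒱) :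
    WedgeNonvanishing.StableUnder Δ A (𝒱.comap (frameRead (fun g x => (A g x : W →ₗ[ℂ] W)) x₀)) := by
  have hA' : Cocycle (fun g x => (A g x : W →ₗ[ℂ] W)) := fun g h x w => by simpa using hA g h x w
  intro γ hγ u hu
  obtain ⟨u', hu', h⟩ := stable_comap (fun g x => (A g x : W →ₗ[ℂ] W)) x₀ hA' Δ 𝒱 h𝒱 γ hγ u hu
  exact ⟨u', hu', fun x => by simpa using h x⟩

/-- pv03's literal `StableUnder` for a supremum of stable spaces. -/
theorem stableUnder_iSup {D : Type*} (A : G → X → (W →L[ℂ] W)) (Δ : Subgroup G)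
    (gen : D → Submodule ℂ (X → W)) (h : ∀ d, WedgeNonvanishing.StableUnder Δ A (gen d)) :
    WedgeNonvanishing.StableUnder Δ A (⨆ d, gen d) := by
  intro γ hγ u hu
  have h' : ∀ d, ∀ γ ∈ Δ, ∀ u ∈ gen d, ∃ u' ∈ gen d, ∀ x,
      u' (γ • x) = (fun g x => (A g x : W →ₗ[ℂ] W)) γ x (u x) :=
    fun d γ hγ u hu => by
      obtain ⟨u', hu', hrel⟩ := h d γ hγ u hu
      exact ⟨u', hu', fun x => by simpa using hrel x⟩
  obtain ⟨u', hu', hrel⟩ := stable_iSup (fun g x => (A g x : W →ₗ[ℂ] W)) Δ gen h' γ hγ u hu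
  exact ⟨u', hu', fun x => by simpa using hrel x⟩

end CLM

section LineSpan

/-- **Applied to pv02's N33c (KERNEL, run 18)**: for the data of `P43_lineSpan` and any ball model
`(X, x₀, A)` of `G_U(L_{0,ι₁}) = U(2,1)` with the cocycle identity, the spaces of one-forms `R⁻¹ 𝒰_i` on the ball are
stable under push-forward by every `γ_∞`, `γ ∈ G_U(L₀)` — the BALL-LEVEL Hecke-translate equivariance of theta
one-forms (LEMMAS v3 §8 (iv)), from the group-level one. -/
theorem stable_comap_U (D : P43.LineSpanData) (hN : D.N33c_statement) {X : Type*} [MulAction D.Ginf X]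
    (A : D.Ginf → X → (D.V →ₗ[ℂ] D.V)) (x₀ : X) (hA : Cocycle A) (i : Fin 2) :
    ∀ γ ∈ D.Γ, ∀ u ∈ (D.U i).comap (frameRead A x₀),
      ∃ u' ∈ (D.U i).comap (frameRead A x₀), ∀ x, u' (γ.1 • x) = A γ.1 x (u x) := by
  intro γ hγ u hu
  refine ⟨push A γ.1 u, ?_, fun x => push_apply_smul A γ.1 u x⟩
  rw [Submodule.mem_comap] at hu ⊢
  rw [frameRead_push A x₀ hA]
  have hmap := (hN i).2.1 γ⁻¹ (D.Γ.inv_mem hγ)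
  exact hmap.le (Submodule.mem_map_of_mem hu)

end LineSpan

end P43Frame
end PerL34
end HodgeCM
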